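import Summits.QuantumAdvantage.QuantumAdvantage.Theses.SelmerBand

/-!
# Redirect strategist r1 (crux `PriorBand`, stmt-QuantumAdvantage-17066) — where the summit sits in `SelmerBand`

Kernel-checked factorisation of the route's deciding theorem
`closes : PriorBand → SelmerMemBQP → BeyondConstant → QuantumAdvantage`:

* `not_selmerMemBPP_of_priorBand_beyondConstant` : `PriorBand → BeyondConstant → ¬ SelmerMemBPP`
  (verbatim the body of `closes` after its first line) — given the theorem-grade band, the
  hypothesis-type crux `BeyondConstant` ALONE delivers the `BPP`-half of the summit instance for the
  witness language `L_Sel`;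
* `quantumAdvantage_of_mem_of_not_mem` : `SelmerMemBQP → ¬ SelmerMemBPP → QuantumAdvantage` (one line).

So `PriorBand` (a theorem of arithmetic statistics in print) only calibrates the constant-rule baseline;
the summit content of the route is `SelmerMemBQP ∧ ¬ SelmerMemBPP`, an INSTANCE of `∃ L, L ∈ BQP ∧ L ∉ BPP`,
carried by `BeyondConstant` (average-case hardness, stronger than `¬ SelmerMemBPP`) and `SelmerMemBQP`.
-/

-- `Summit.<Summit>.<Problem>`: for the single-conjunct summit the duplicate namespace is mandated.
set_option linter.dupNamespace false

noncomputable section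

namespace Summit.QuantumAdvantage.QuantumAdvantage.Cruxes.PriorBand.RedirectR1

open Summit.QuantumAdvantage.QuantumAdvantage.Theses.SelmerBand

/-- `L_Sel ∈ BPP`, typed verbatim like the route's `SelmerMemBQP` with `BQP` replaced by `BPP`. -/
def SelmerMemBPP : Prop :=
  let P : ℤ × ℤ → Prop := fun AB => Nat.card ((Literature.NumberTheory.EllipticCurves.shortWeierstrass AB).selmerGroup 2) ≤ 2; let enc : ℤ × ℤ → List Bool := fun AB => Computability.encodeNat (Encodable.encode AB); let L : Language Bool := enc '' {AB | Literature.NumberTheory.EllipticCurves.IsInHeightFamily AB ∧ P AB}; L ∈ Literature.Computability.Complexity.BPP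

/-- The summit from the instance: `L_Sel ∈ BQP`, `L_Sel ∉ BPP` (pure logic). -/
theorem quantumAdvantage_of_mem_of_not_mem (hMem : SelmerMemBQP) (hNot : ¬ SelmerMemBPP) :
    QuantumAdvantage := by
  classical
  set P : ℤ × ℤ → Prop := fun AB => Nat.card ((Literature.NumberTheory.EllipticCurves.shortWeierstrass AB).selmerGroup 2) ≤ 2 with hP
  set enc : ℤ × ℤ → List Bool := fun AB => Computability.encodeNat (Encodable.encode AB) with henc
  set L : Language Bool := enc '' {AB | Literature.NumberTheory.EllipticCurves.IsInHeightFamily AB ∧ P AB} with hL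
  have hMem' : L ∈ Literature.Computability.Cryptography.BQP := hMem
  have hNot' : L ∉ Literature.Computability.Complexity.BPP := hNot
  exact ⟨L, hMem', hNot'⟩

/-- **Smuggling locus.** The band and the hypothesis-type crux already give `L_Sel ∉ BPP`
(this is the body of the route's `closes`, unchanged). -/
theorem not_selmerMemBPP_of_priorBand_beyondConstant (hBand : PriorBand) (hHyp : BeyondConstant) :
    ¬ SelmerMemBPP := by
  classical
  set P : ℤ × ℤ → Prop := fun AB => Nat.card ((Literature.NumberTheory.EllipticCurves.shortWeierstrass AB).selmerGroup 2) ≤ 2 with hP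
  set enc : ℤ × ℤ → List Bool := fun AB => Computability.encodeNat (Encodable.encode AB) with henc
  set L : Language Bool := enc '' {AB | Literature.NumberTheory.EllipticCurves.IsInHeightFamily AB ∧ P AB} with hL
  intro hBPP0
  have hBPP : L ∈ Literature.Computability.Complexity.BPP := hBPP0
  -- BPP error reduction to 1/200 (tree: Arora–Barak Thm 7.10, discharged)
  obtain ⟨A, hApoly, -, hAcorrect⟩ :=
    Literature.Computability.Complexity.exists_randAlg_error_le_of_mem_BPP_holds hBPP (1 / 200) (by norm_num)
  have hfreq := hHyp A hApoly
  -- a level X where the hypothesis bound, the band and X ≥ 5 hold together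
  obtain ⟨X, hX1, hX2⟩ := (hfreq.and_eventually (hBand.and (Filter.eventually_ge_atTop 5))).exists
  obtain ⟨⟨hlow, hhigh⟩, hX5⟩ := hX2
  -- the family below X is nonempty for X ≥ 5: (A, B) = (1, 0) has naive height 4
  have hmem : ((1 : ℤ), (0 : ℤ)) ∈ Literature.NumberTheory.EllipticCurves.heightFamilyBelow X := by
    rw [Literature.NumberTheory.EllipticCurves.mem_heightFamilyBelow_iff]
    refine ⟨⟨by norm_num, ?_⟩, ?_⟩
    · rintro p hp ⟨h4, _⟩
      have h1 : (p : ℤ) ^ 4 ∣ 1 := h4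
      have hle := Int.le_of_dvd one_pos h1
      have hp2 : (2 : ℤ) ≤ p := by exact_mod_cast hp.two_le
      have hpow : (2 : ℤ) ^ 4 ≤ (p : ℤ) ^ 4 := pow_le_pow_left₀ (by norm_num) hp2 4
      norm_num at hpow
      omega
    · have h5 : (5 : ℤ) ≤ (X : ℤ) := by exact_mod_cast hX5
      show max (4 * |(1 : ℤ)| ^ 3) (27 * (0 : ℤ) ^ 2) < (X : ℤ)
      norm_num
      omega
  have hcard_pos : (0 : ℝ) < ((Literature.NumberTheory.EllipticCurves.heightFamilyBelow X).card : ℝ) := by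
    exact_mod_cast Finset.card_pos.mpr ⟨_, hmem⟩
  -- the amplified BPP decider succeeds on average with probability ≥ 1 - 1/200
  have havg : 1 - (1 : ℝ) / 200 ≤ (∑ AB ∈ Literature.NumberTheory.EllipticCurves.heightFamilyBelow X, A.pr id (enc AB) {Set.boolIndicator L (enc AB)}) / ((Literature.NumberTheory.EllipticCurves.heightFamilyBelow X).card : ℝ) := by
    rw [le_div_iff₀ hcard_pos]
    have hsum : ∑ AB ∈ Literature.NumberTheory.EllipticCurves.heightFamilyBelow X, (1 - (1 : ℝ) / 200) ≤ ∑ AB ∈ Literature.NumberTheory.EllipticCurves.heightFamilyBelow X, A.pr id (enc AB) {Set.boolIndicator L (enc AB)} :=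
      Finset.sum_le_sum fun AB _ => hAcorrect (enc AB)
    rw [Finset.sum_const, nsmul_eq_mul] at hsum
    linarith
  -- the band caps the constant rule at 14/15 + 1/100
  have hmax : max (Literature.NumberTheory.EllipticCurves.heightProportion P X) (1 - Literature.NumberTheory.EllipticCurves.heightProportion P X) ≤ 14 / 15 + 1 / 100 := by
    apply max_le hhigh
    linarith
  have hfin : (∑ AB ∈ Literature.NumberTheory.EllipticCurves.heightFamilyBelow X, A.pr id (enc AB) {Set.boolIndicator L (enc AB)}) / ((Literature.NumberTheory.EllipticCurves.heightFamilyBelow X).card : ℝ) ≤ max (Literature.NumberTheory.EllipticCurves.heightProportion P X) (1 - Literature.NumberTheory.EllipticCurves.heightProportion P X) + 1 / 20 := hX1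
  linarith

/-- The route's deciding theorem, re-derived through the instance (sanity: same conclusion BY NAME). -/
theorem closes_via_instance (hBand : PriorBand) (hMem : SelmerMemBQP) (hHyp : BeyondConstant) :
    QuantumAdvantage :=
  quantumAdvantage_of_mem_of_not_mem hMem (not_selmerMemBPP_of_priorBand_beyondConstant hBand hHyp)

end Summit.QuantumAdvantage.QuantumAdvantage.Cruxes.PriorBand.RedirectR1

end
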